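import Summits.KontsevichZagierPeriods.KontsevichZagierPeriods.Theorems.LinRedNormalFormArrangementNormalFormStubRebaseSimplePosOnePosHUChoice

/-!
# Stub `stub_rebaseSimplePosOnePos` (crux `ArrangementNormalForm`, line `janus-bands`) —
part `HULocal`: the chambers of a localised thin parallel cell (`B = 2`)

Towards the residue `HU` of the one-fibre rebase over the base `(x₁, x₂, y)`. The inner piece of
a thin parallel cell localised at its triple point `X` (part `QuadLocal`) is cut (rule 1a,
`RebasePos.cutCell`) along the two axis-parallel lines through `X` and along every NEAR active
silent factor (`Lᵢ(X) = 0`): `RebasePos.good_of_lineCuts` reduces a product cell to the chambers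
of a list of `x'`-lines, on each of which every line of the list has a strict constant sign.
On a chamber the signs of `x₀ − X₀`, `x₁ − X₁` name its quadrant `(σ₀, σ₁)`, the near factors
have constant signs, and `RebasePos.good_chamber` (part `HURatio`) applies along the direction
`dirQ σ₀ σ₁ q (nuQ u v σ₀ σ₁ q θ)` of part `HUChoice`, GIVEN its algebraic facts for all four
quadrants (`hA`, the conclusion of `RebasePos.exists_goodDirs`) and the closeness facts on the
inner piece (`hB`, part `HUClose`): `RebasePos.good_inner`, registered as
`rebaseSimplePos_goodInner`.

References: M. Kontsevich, D. Zagier, *Periods* (2001), §1.2, rule (1a).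
-/

noncomputable section

open Set MeasureTheory MvPolynomial
open Literature.NumberTheory.Transcendental Literature.ModelTheory.ExponentialFields

namespace Summit.KontsevichZagierPeriods.ArrangementNormalForm.JanusBands

namespace RebasePos

open SeparatePos

section Local

variable {m : ℕ} (L : Fin m → (Fin 2 → ℚ) × ℚ) (e : Fin m → ℕ) (ℓ₁ ℓ₂ : (Fin 2 → ℚ) × ℚ)

/-- **Cutting a product cell along a list of `x'`-lines** (rule 1a, `cutCell` iterated): `[t]` is
good as soon as every chamber is — a sub-datum with the same integrand over a product cell with
more rows, whose rows imply the original ones, on which every line of the list has a strict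
constant sign. -/
theorem good_of_lineCuts (ylo yhi : (Fin 2 → ℚ) × ℚ) (u v : (Fin (2 + 1) → ℚ) × ℚ)
    (gs : List ((Fin 2 → ℚ) × ℚ)) (hgs : ∀ g ∈ gs, g ≠ 0) :
    ∀ {n n₀ : ℕ} (t : KZ.IntegralRep (2 + 1 + 1)) (N : Fin n → (Fin (2 + 1) → ℚ) × ℚ)
      (N₀ : Fin n₀ → (Fin 2 → ℚ) × ℚ),
      t.domain = gDom 2 1 n N (fun _ => Sum.inr u) (fun _ => Sum.inr v) →
      (∀ z : Fin (2 + 1 + 1) → ℝ, (∀ j, 0 < affF 2 1 (N j) z) ↔ ((∀ j, 0 < affB 2 1 (N₀ j) z) ∧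
        affB 2 1 ylo z < z (Fin.castAdd 1 (Fin.last 2)) ∧ z (Fin.castAdd 1 (Fin.last 2)) < affB 2 1 yhi z)) →
      (∀ {n' n₀' : ℕ} (t' : KZ.IntegralRep (2 + 1 + 1)) (N' : Fin n' → (Fin (2 + 1) → ℚ) × ℚ)
        (N₀' : Fin n₀' → (Fin 2 → ℚ) × ℚ), t'.domain ⊆ t.domain → t'.integrand = t.integrand →
        t'.domain = gDom 2 1 n' N' (fun _ => Sum.inr u) (fun _ => Sum.inr v) →
        (∀ z : Fin (2 + 1 + 1) → ℝ, (∀ j, 0 < affF 2 1 (N' j) z) ↔ ((∀ j, 0 < affB 2 1 (N₀' j) z) ∧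
          affB 2 1 ylo z < z (Fin.castAdd 1 (Fin.last 2)) ∧ z (Fin.castAdd 1 (Fin.last 2)) < affB 2 1 yhi z)) →
        (∀ z : Fin (2 + 1 + 1) → ℝ, (∀ j, 0 < affF 2 1 (N' j) z) → ∀ j, 0 < affF 2 1 (N j) z) →
        (∀ g ∈ gs, (∀ z : Fin (2 + 1 + 1) → ℝ, (∀ j, 0 < affF 2 1 (N' j) z) → 0 < affB 2 1 g z) ∨
          (∀ z : Fin (2 + 1 + 1) → ℝ, (∀ j, 0 < affF 2 1 (N' j) z) → affB 2 1 g z < 0)) →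
        ∃ c ∈ AddSubgroup.closure (GGset 2 2 1), KZ.of t' - c ∈ KZ.relations) →
      ∃ c ∈ AddSubgroup.closure (GGset 2 2 1), KZ.of t - c ∈ KZ.relations := by
  induction gs with
  | nil =>
    intro n n₀ t N N₀ hd hs H
    exact H t N N₀ Subset.rfl rfl hd hs (fun z hz => hz) fun g hg => absurd hg List.not_mem_nil
  | cons g gs ih =>
    intro n n₀ t N N₀ hd hs H
    have hg : g ≠ 0 := hgs g List.mem_cons_self
    have hgs' : ∀ g' ∈ gs, g' ≠ 0 := fun g' hg' => hgs g' (List.mem_cons_of_mem _ hg')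
    obtain ⟨t₁, t₂, hsub₁, hsub₂, hi₁, hi₂, hd₁, hd₂, hs₁, hs₂, hrel⟩ :=
      cutCell t N N₀ ylo yhi u v hd hs g hg
    refine good_of_split hrel
      (ih hgs' t₁ _ _ hd₁ hs₁ fun t' N' N₀' hsub hi hd' hs' hbase hsigns => ?_)
      (ih hgs' t₂ _ _ hd₂ hs₂ fun t' N' N₀' hsub hi hd' hs' hbase hsigns => ?_)
    · refine H t' N' N₀' (hsub.trans hsub₁) (hi.trans hi₁) hd' hs'
        (fun z hz => (rows_snoc (hbase z hz)).1) fun g' hg' => ?_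
      rcases List.mem_cons.1 hg' with rfl | hg'
      · refine Or.inl fun z hz => ?_
        have h := (rows_snoc (hbase z hz)).2
        rwa [affF_liftX] at h
      · exact hsigns g' hg'
    · refine H t' N' N₀' (hsub.trans hsub₂) (hi.trans hi₂) hd' hs'
        (fun z hz => (rows_snoc (hbase z hz)).1) fun g' hg' => ?_
      rcases List.mem_cons.1 hg' with rfl | hg'
      · refine Or.inr fun z hz => ?_
        have h := (rows_snoc (hbase z hz)).2
        rw [affF_neg', affF_liftX] at h
        linarith
      · exact hsigns g' hg'

/-- The row `x₀ − X₀`. -/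
def axisRow0 (X : Fin 2 → ℚ) : (Fin 2 → ℚ) × ℚ := (![1, 0], -X 0)

/-- The row `x₁ − X₁`. -/
def axisRow1 (X : Fin 2 → ℚ) : (Fin 2 → ℚ) × ℚ := (![0, 1], -X 1)

/-- `axisRow0` evaluates to `x₀ − X₀`. -/
theorem affB_axisRow0 (X : Fin 2 → ℚ) (z : Fin (2 + 1 + 1) → ℝ) : affB 2 1 (axisRow0 X) z = z 0 - X 0 := by
  rw [affB_three, axisRow0]
  simp [sub_eq_add_neg]

/-- `axisRow1` evaluates to `x₁ − X₁`. -/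
theorem affB_axisRow1 (X : Fin 2 → ℚ) (z : Fin (2 + 1 + 1) → ℝ) : affB 2 1 (axisRow1 X) z = z 1 - X 1 := by
  rw [affB_three, axisRow1]
  simp [sub_eq_add_neg]

/-- A sign read off a strict constant sign of `x − X`. -/
theorem exists_sign_of_const {P : (Fin (2 + 1 + 1) → ℝ) → Prop} {f : (Fin (2 + 1 + 1) → ℝ) → ℝ}
    (h : (∀ z, P z → 0 < f z) ∨ (∀ z, P z → f z < 0)) :
    ∃ σ : ℚ, σ * σ = 1 ∧ ∀ z, P z → 0 < (σ : ℝ) * f z := by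
  rcases h with h | h
  · exact ⟨1, by norm_num, fun z hz => by rw [Rat.cast_one, one_mul]; exact h z hz⟩
  · exact ⟨-1, by norm_num, fun z hz => by rw [Rat.cast_neg, Rat.cast_one]; nlinarith [h z hz]⟩

/-- **The inner piece of a localised thin parallel cell is good**, GIVEN the algebraic facts of
the re-selection for all four quadrants (`hA`) and the closeness facts on the piece (`hB`). See
the module docstring. -/
theorem good_inner {n n₀ : ℕ} (t : KZ.IntegralRep (2 + 1 + 1)) (N : Fin n → (Fin (2 + 1) → ℚ) × ℚ)
    (N₀ : Fin n₀ → (Fin 2 → ℚ) × ℚ) (ylo yhi : (Fin 2 → ℚ) × ℚ) (p : MvPolynomial (Fin 2) ℚ)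
    (u v : (Fin (2 + 1) → ℚ) × ℚ) (hbd : Bornology.IsBounded t.domain)
    (hdom : t.domain = gDom 2 1 n N (fun _ => Sum.inr u) (fun _ => Sum.inr v))
    (hint : EqOn t.integrand (glit 2 1 p L e ℓ₁ ℓ₂ 0 1 (fun _ => some 0)) t.domain)
    (hcell : ∀ z : Fin (2 + 1 + 1) → ℝ, (∀ j, 0 < affF 2 1 (N j) z) → affF 2 1 u z < affF 2 1 v z)
    (hsec : ∀ z : Fin (2 + 1 + 1) → ℝ, (∀ j, 0 < affF 2 1 (N j) z) ↔ ((∀ j, 0 < affB 2 1 (N₀ j) z) ∧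
      affB 2 1 ylo z < z (Fin.castAdd 1 (Fin.last 2)) ∧ z (Fin.castAdd 1 (Fin.last 2)) < affB 2 1 yhi z))
    (X : Fin 2 → ℚ) (Y q θ : ℚ) (hq : 0 < q) (hθ0 : 0 < θ) (hθ1 : θ < 1)
    (hA : ∀ σ₀ σ₁ : ℚ, σ₀ * σ₀ = 1 → σ₁ * σ₁ = 1 →
      dirQ σ₀ σ₁ q (nuQ u v σ₀ σ₁ q θ) (Fin.last 2) ≠ 0 ∧
      dd u (dirQ σ₀ σ₁ q (nuQ u v σ₀ σ₁ q θ)) ≠ 0 ∧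
      dd u (dirQ σ₀ σ₁ q (nuQ u v σ₀ σ₁ q θ)) + θ * dd (v - u) (dirQ σ₀ σ₁ q (nuQ u v σ₀ σ₁ q θ)) = 0 ∧
      (∀ j, jjE e j ≠ 0 → (jjL L ℓ₂ j).1 ≠ 0 → dd (jjL L ℓ₂ j) (dirQ σ₀ σ₁ q (nuQ u v σ₀ σ₁ q θ)) ≠ 0) ∧
      (∀ j j', jjE e j ≠ 0 → jjE e j' ≠ 0 → dd (jjL L ℓ₂ j) (dirQ σ₀ σ₁ q (nuQ u v σ₀ σ₁ q θ)) ≠ 0 →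
        dd (jjL L ℓ₂ j') (dirQ σ₀ σ₁ q (nuQ u v σ₀ σ₁ q θ)) ≠ 0 →
        dd (jjL L ℓ₂ j') (dirQ σ₀ σ₁ q (nuQ u v σ₀ σ₁ q θ)) • jjL L ℓ₂ j ≠
          dd (jjL L ℓ₂ j) (dirQ σ₀ σ₁ q (nuQ u v σ₀ σ₁ q θ)) • jjL L ℓ₂ j' →
        ¬ (∃ i i' : Fin m, j = Fin.castSucc i ∧ j' = Fin.castSucc i' ∧ valX (L i) X = 0 ∧ valX (L i') X = 0) →
        evQ (resF (jjL L ℓ₂ j) (jjL L ℓ₂ j') (dirQ σ₀ σ₁ q (nuQ u v σ₀ σ₁ q θ))) ![X 0, X 1, Y] ≠ 0) ∧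
      (∀ j, jjE e j ≠ 0 → dd (jjL L ℓ₂ j) (dirQ σ₀ σ₁ q (nuQ u v σ₀ σ₁ q θ)) ≠ 0 →
        ¬ (∃ i : Fin m, j = Fin.castSucc i ∧ valX (L i) X = 0) → evQ (jjL L ℓ₂ j) ![X 0, X 1, Y] ≠ 0))
    (hB : ∀ σ₀ σ₁ : ℚ, σ₀ * σ₀ = 1 → σ₁ * σ₁ = 1 →
      (∀ c : (Fin (2 + 1) → ℚ) × ℚ,
        ((∃ j, c = jjL L ℓ₂ j) ∨ (∃ j j', c = resF (jjL L ℓ₂ j) (jjL L ℓ₂ j') (dirQ σ₀ σ₁ q (nuQ u v σ₀ σ₁ q θ)))) →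
        evQ c ![X 0, X 1, Y] ≠ 0 → ∀ z : Fin (2 + 1 + 1) → ℝ, (∀ j, 0 < affF 2 1 (N j) z) →
        2 * |affF 2 1 c z - (evQ c ![X 0, X 1, Y] : ℝ)| < |(evQ c ![X 0, X 1, Y] : ℝ)|) ∧
      (∀ j, ∀ z : Fin (2 + 1 + 1) → ℝ, (∀ j, 0 < affF 2 1 (N j) z) →
        |affF 2 1 (jjL L ℓ₂ j) z - (evQ (jjL L ℓ₂ j) ![X 0, X 1, Y] : ℝ)| ≤ 1)) :
    ∃ c ∈ AddSubgroup.closure (GGset 2 2 1), KZ.of t - c ∈ KZ.relations := by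
  classical
  -- the list of lines: the two axes through `X` and the near active silent factors
  set nearL : List ((Fin 2 → ℚ) × ℚ) :=
    ((List.finRange m).filter fun i => e i ≠ 0 ∧ (L i).1 ≠ 0 ∧ valX (L i) X = 0).map L with hnearL
  have hmem : ∀ i, e i ≠ 0 → (L i).1 ≠ 0 → valX (L i) X = 0 → L i ∈ nearL := fun i he hL hv => by
    rw [hnearL, List.mem_map]
    exact ⟨i, List.mem_filter.2 ⟨List.mem_finRange i, by simp [he, hL, hv]⟩, rfl⟩
  set gs : List ((Fin 2 → ℚ) × ℚ) := axisRow0 X :: axisRow1 X :: nearL with hgs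
  have hgs0 : ∀ g ∈ gs, g ≠ 0 := by
    intro g hg
    rw [hgs, List.mem_cons, List.mem_cons] at hg
    rcases hg with rfl | rfl | hg
    · intro h
      have := congrArg (fun c : (Fin 2 → ℚ) × ℚ => c.1 0) h
      simp [axisRow0] at this
    · intro h
      have := congrArg (fun c : (Fin 2 → ℚ) × ℚ => c.1 1) h
      simp [axisRow1] at this
    · rw [hnearL, List.mem_map] at hg
      obtain ⟨i, hi, rfl⟩ := hg
      have hL : (L i).1 ≠ 0 := by
        have := (List.mem_filter.1 hi).2
        simp only [decide_eq_true_eq] at this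
        exact this.2.1
      exact fun h => hL (by rw [h]; rfl)
  refine good_of_lineCuts ylo yhi u v gs hgs0 t N N₀ hdom hsec
    fun t' N' N₀' hsub hi hd' hs' hbase hsigns => ?_
  -- the quadrant of the chamber
  obtain ⟨σ₀, hσ₀, hq0⟩ := exists_sign_of_const (hsigns (axisRow0 X) (by rw [hgs]; simp))
  obtain ⟨σ₁, hσ₁, hq1⟩ := exists_sign_of_const (hsigns (axisRow1 X) (by rw [hgs]; simp))
  obtain ⟨hd, hdu, hlev, hact, hres0, hfar0⟩ := hA σ₀ σ₁ hσ₀ hσ₁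
  obtain ⟨hclose₁, hclose₂⟩ := hB σ₀ σ₁ hσ₀ hσ₁
  refine good_chamber L e ℓ₁ ℓ₂ t' N' p u v (hbd.subset hsub) hd' (by rw [hi]; exact hint.mono hsub)
    (fun z hz => hcell z (hbase z hz)) σ₀ σ₁ q hσ₀ hσ₁ hq (dirQ σ₀ σ₁ q (nuQ u v σ₀ σ₁ q θ)) rfl rfl hd
    θ hθ0 hθ1 hdu hlev X ![X 0, X 1, Y] (fun z hz => ?_) hact hres0 (fun i he hL hv => ?_) hfar0
    (fun c hc h0 z hz => hclose₁ c hc h0 z (hbase z hz)) (fun j z hz => hclose₂ j z (hbase z hz))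
  · have h0 := hq0 z hz
    have h1 := hq1 z hz
    rw [affB_axisRow0] at h0
    rw [affB_axisRow1] at h1
    exact ⟨h0, h1⟩
  · exact hsigns (L i) (by rw [hgs]; exact List.mem_cons_of_mem _ (List.mem_cons_of_mem _ (hmem i he hL hv)))

end Local

end RebasePos

/-- **Registered part of `stub_rebaseSimplePosOnePos` (line `janus-bands`): cutting a product
cell over the base `(x₁, x₂, y)` along a list of `x'`-lines** (`RebasePos.good_of_lineCuts`, rule
1a iterated): the datum is good as soon as every chamber is (same integrand, more rows implying
the original ones, every line of the list of a strict constant sign on the chamber). With the two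
axes through the triple point and the near silent factors this feeds `RebasePos.good_chamber`
(`RebasePos.good_inner`). -/
theorem rebaseSimplePos_goodOfLineCuts (ylo yhi : (Fin 2 → ℚ) × ℚ) (u v : (Fin (2 + 1) → ℚ) × ℚ) (gs : List ((Fin 2 → ℚ) × ℚ)) (hgs : ∀ g ∈ gs, g ≠ 0) (n n₀ : ℕ) (t : KZ.IntegralRep (2 + 1 + 1)) (N : Fin n → (Fin (2 + 1) → ℚ) × ℚ) (N₀ : Fin n₀ → (Fin 2 → ℚ) × ℚ) (hdom : t.domain = SeparatePos.gDom 2 1 n N (fun _ => Sum.inr u) (fun _ => Sum.inr v)) (hsec : ∀ z : Fin (2 + 1 + 1) → ℝ, (∀ j, 0 < SeparatePos.affF 2 1 (N j) z) ↔ ((∀ j, 0 < SeparatePos.affB 2 1 (N₀ j) z) ∧ SeparatePos.affB 2 1 ylo z < z (Fin.castAdd 1 (Fin.last 2)) ∧ z (Fin.castAdd 1 (Fin.last 2)) < SeparatePos.affB 2 1 yhi z)) (H : ∀ {n' n₀' : ℕ} (t' : KZ.IntegralRep (2 + 1 + 1)) (N' : Fin n' → (Fin (2 + 1) → ℚ)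 × ℚ) (N₀' : Fin n₀' → (Fin 2 → ℚ) × ℚ), t'.domain ⊆ t.domain → t'.integrand = t.integrand → t'.domain = SeparatePos.gDom 2 1 n' N' (fun _ => Sum.inr u) (fun _ => Sum.inr v) → (∀ z : Fin (2 + 1 + 1) → ℝ, (∀ j, 0 < SeparatePos.affF 2 1 (N' j) z) ↔ ((∀ j, 0 < SeparatePos.affB 2 1 (N₀' j) z) ∧ SeparatePos.affB 2 1 ylo z < z (Fin.castAdd 1 (Fin.last 2)) ∧ z (Fin.castAdd 1 (Fin.last 2)) < SeparatePos.affB 2 1 yhi z)) → (∀ z : Fin (2 + 1 + 1) → ℝ, (∀ j, 0 < SeparatePos.affF 2 1 (N' j) z) → ∀ j, 0 < SeparatePos.affF 2 1 (N j) z) → (∀ g ∈ gs, (∀ z : Fin (2 + 1 + 1) → ℝ, (∀ j, 0 < SeparatePos.affF 2 1 (N' j) z) → 0 < SeparatePos.affB 2 1 g z) ∨ (∀ z : Fin (2 + 1 + 1) → ℝ, (∀ j, 0 < SeparatePos.affF 2 1 (N' j) z) → SeparatePos.affB 2 1 g z < 0)) → ∃ c ∈ AddSubgroup.closure (SeparatePos.GGset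 2 2 1), KZ.of t' - c ∈ KZ.relations) : ∃ c ∈ AddSubgroup.closure (SeparatePos.GGset 2 2 1), KZ.of t - c ∈ KZ.relations :=
  RebasePos.good_of_lineCuts ylo yhi u v gs hgs t N N₀ hdom hsec H

end Summit.KontsevichZagierPeriods.ArrangementNormalForm.JanusBands
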